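import Literature.NumberTheory.EllipticCurves.CMFormalActionNilIdealPointsY
import Literature.NumberTheory.EllipticCurves.CMFormalActionTaylorOfTransformationProofs
import Literature.NumberTheory.EllipticCurves.X049IntegralModelReadings
import HarnessLib

/-!
# The CM identities `hidX`/`hidY` of the formal action of `X₀(49)` OVER A DATA RING (the reading ring), re-centred at `b = 0`
# (de Shalit II.1.10 / II.4.9 (ii); Silverman AT II.1.1 — brick B8b of the `(α)` assembly; proofs only)

Topic `NumberTheory/EllipticCurves` (theorems only; no definition, no named fact, no instance, no `sorry`).
`CMFormalActionNilIdealPointsChart.some_add_ptOfZ_evalPt₁_eq_of_cm_identities` (cf2c-w4 g15) turns two series identities `hidX`, `hidY` over a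
coefficient ring `A` — for a model `W/A`, points `(x₀,y₀)`, `(x₁,y₁)`, a series `T ∈ A⟦X⟧`, polynomials `P, Q ∈ A[X]`, a scalar `α` and a shift
`b` — into the point identity `P₁^α ⊕ P(T t) = Z` on the local curve.  `CMFormalActionTaylorOfTransformationProofs` (cf2c-w4 g14) proves the two
identities over `ℂ` for the model coordinates `x = ℘ − b₂/12`, `y = (℘′ − a₁x − a₃)/2`, the formal CM action `T = exp_W(α log_W)` and a
transformation pair `P(℘ z) = ℘(αz)Q(℘ z)`, WITH THE SHIFT `b = b₂/12`.  For the model `[1,−1,0,−2,−1]` of `X₀(49)` one has `b₂/12 = −1/4`,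
which is NOT `2`-integral, so it cannot be lifted to the `𝔓`-adic reading ring at `v ∣ 2`.  This file (i) RE-CENTRES the two identities at
`b = 0` by moving the shift (and an arbitrary scalar `s`, to clear denominators) into the polynomials —
`Q̂ = s·Q(X + b)`, `P̂ = s·(P(X + b) − b·Q(X + b))` — over any commutative ring (`cmX_identity_recenter`, `cmY_identity_recenter`: pure algebra,
the identities are linear in `(P, Q)`), and (ii) DESCENDS them along an injective reading `φ : R →+* ℂ` of a data ring `R` (CMF-pt §0
`translateX_subst_add_C_mul_aeval_eq_of_map`, CM-ptY §0 `cmY_identity_of_map_eq`): ★★ `cmX_identity_of_reading` / ★★ `cmY_identity_of_reading` — for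
`R`-lifts `x₀ y₀ x₁ y₁ αR`, `T_R` (`T_R^φ = exp_W((φ αR) log_W)`, e.g. brick B8a `CMFormalActionReadingSeries.exists_readingSeries_cm7FormalMulBy`) and `P̂_R, Q̂_R`
of the complex data, the identities hold OVER `R` with `b = 0`, in EXACTLY the binder shapes `hidX`/`hidY` of
`some_add_ptOfZ_evalPt₁_eq_of_cm_identities` (`W := [1,−1,0,−2,−1]` over `R`, `b := 0`).  For the lane: `R := readingRing E hE`
(`DeShalit1987/RayClassFieldPAdicReading`), `φ := g.comp (readingRing E hE).subtype` for a ring map `g : K(𝔪) → ℂ` (injective: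
`g.injective.comp Subtype.val_injective`), `T_R` from `CMFormalActionReadingSeries.exists_readingSeries_cm7FormalMulBy` (its clause (iii) with `g`).
What is NOT here: the existence of the lifts (`x(ξ(Ω₁))` etc. are `v`-integral — brick B1; the certificate polynomials and `s` — brick B7 /
`CMCert.check7`), which enter as hypotheses.  Cell `bsd-print-cf2`, width seat `bsd-line-cf2-p1-w7` g15; nothing here closes a crux; no summit
statement is proved; BSD is not proved by any of this.

## References
* [deShalit1987] E. de Shalit, *Iwasawa theory of elliptic curves with complex multiplication* (1987), II §1.10 (p. 39), II §4.9 (ii) (p. 62–63).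
* [SilvermanATAEC1994] J. H. Silverman, *Advanced Topics in the Arithmetic of Elliptic Curves* (1994), II Prop. 1.1, §II.2.
* [SilvermanAEC2009] J. H. Silverman, *The Arithmetic of Elliptic Curves*, 2nd ed. (2009), III §1 (change of the constant `b₂/12`), IV.1.
-/

noncomputable section

open PowerSeries

namespace Literature.NumberTheory.EllipticCurves

/-! ## §1. Re-centring the shift `b ↦ 0`: `Q̂ = s·Q(X + b)`, `P̂ = s·(P(X + b) − b·Q(X + b))` -/

section Recenter

variable {A : Type*} [CommRing A]

/-- `algebraMap A A⟦X⟧ b = C b`. [folklore] -/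
private theorem algebraMap_powerSeries_self (b : A) : algebraMap A (PowerSeries A) b = C b := by
  rw [PowerSeries.algebraMap_apply]; rfl

/-- `(F + C 0)`-evaluation of a `(X + b)`-composite is `(F + C b)`-evaluation: `p(X + b)|_{X = F} = p|_{X = F + b}`.
[cite: SilvermanAEC2009, III §1] -/
theorem aeval_add_C_zero_comp_X_add_C (F : PowerSeries A) (b : A) (p : Polynomial A) :
    Polynomial.aeval (F + C 0) (p.comp (Polynomial.X + Polynomial.C b)) = Polynomial.aeval (F + C b) p := by
  rw [map_zero, add_zero, Polynomial.aeval_comp, map_add, Polynomial.aeval_X, Polynomial.aeval_C, algebraMap_powerSeries_self]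

/-- `Q̂ = s·Q(X + b)` evaluated at `F + 0` is `s·Q(F + b)`. [cite: SilvermanAEC2009, III §1] -/
theorem aeval_add_C_zero_C_mul_comp (F : PowerSeries A) (b s : A) (Q : Polynomial A) :
    Polynomial.aeval (F + C 0) (Polynomial.C s * Q.comp (Polynomial.X + Polynomial.C b)) = C s * Polynomial.aeval (F + C b) Q := by
  rw [map_mul, Polynomial.aeval_C, aeval_add_C_zero_comp_X_add_C, algebraMap_powerSeries_self]

/-- `P̂ = s·(P(X + b) − b·Q(X + b))` evaluated at `F + 0` is `s·(P(F + b) − b·Q(F + b))`. [cite: SilvermanAEC2009, III §1] -/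
theorem aeval_add_C_zero_C_mul_comp_sub (F : PowerSeries A) (b s : A) (P Q : Polynomial A) :
    Polynomial.aeval (F + C 0) (Polynomial.C s * (P.comp (Polynomial.X + Polynomial.C b) -
        Polynomial.C b * Q.comp (Polynomial.X + Polynomial.C b))) =
      C s * (Polynomial.aeval (F + C b) P - C b * Polynomial.aeval (F + C b) Q) := by
  rw [map_mul, map_sub, map_mul, Polynomial.aeval_C, Polynomial.aeval_C, aeval_add_C_zero_comp_X_add_C, aeval_add_C_zero_comp_X_add_C,
    algebraMap_powerSeries_self, algebraMap_powerSeries_self]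

/-- Derivative of `Q̂`: `(s·Q(X + b))′ = s·Q′(X + b)`. [cite: SilvermanAEC2009, III §1] -/
theorem derivative_C_mul_comp_X_add_C (b s : A) (Q : Polynomial A) :
    Polynomial.derivative (Polynomial.C s * Q.comp (Polynomial.X + Polynomial.C b)) =
      Polynomial.C s * (Polynomial.derivative Q).comp (Polynomial.X + Polynomial.C b) := by
  rw [Polynomial.derivative_C_mul, Polynomial.derivative_comp, Polynomial.derivative_add, Polynomial.derivative_X,
    Polynomial.derivative_C, add_zero, one_mul]

/-- Derivative of `P̂`: `(s·(P(X + b) − b·Q(X + b)))′ = s·(P′(X + b) − b·Q′(X + b))`. [cite: SilvermanAEC2009, III §1] -/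
theorem derivative_C_mul_comp_sub (b s : A) (P Q : Polynomial A) :
    Polynomial.derivative (Polynomial.C s * (P.comp (Polynomial.X + Polynomial.C b) - Polynomial.C b * Q.comp (Polynomial.X + Polynomial.C b))) =
      Polynomial.C s * ((Polynomial.derivative P).comp (Polynomial.X + Polynomial.C b) -
        Polynomial.C b * (Polynomial.derivative Q).comp (Polynomial.X + Polynomial.C b)) := by
  rw [Polynomial.derivative_C_mul, Polynomial.derivative_sub, Polynomial.derivative_C_mul, Polynomial.derivative_comp,
    Polynomial.derivative_comp, Polynomial.derivative_add, Polynomial.derivative_X, Polynomial.derivative_C, add_zero, one_mul, one_mul]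

/-- ★ **Re-centring the `x`-identity**: from `(G + b)·Q(F₀ + b) = P(F₀ + b)` to `(G + 0)·Q̂(F₀ + 0) = P̂(F₀ + 0)` with `Q̂ = s·Q(X + b)`,
`P̂ = s·(P(X + b) − b·Q(X + b))` (the identity is linear in `(P, Q)`; the constant `b` moves into the polynomials).
[cite: SilvermanATAEC1994, II Prop. 1.1] [cite: SilvermanAEC2009, III §1] -/
theorem cmX_identity_recenter {G F₀ : PowerSeries A} {b : A} (s : A) {P Q : Polynomial A}
    (h : (G + C b) * Polynomial.aeval (F₀ + C b) Q = Polynomial.aeval (F₀ + C b) P) :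
    (G + C 0) * Polynomial.aeval (F₀ + C 0) (Polynomial.C s * Q.comp (Polynomial.X + Polynomial.C b)) =
      Polynomial.aeval (F₀ + C 0) (Polynomial.C s * (P.comp (Polynomial.X + Polynomial.C b) -
        Polynomial.C b * Q.comp (Polynomial.X + Polynomial.C b))) := by
  rw [aeval_add_C_zero_C_mul_comp, aeval_add_C_zero_C_mul_comp_sub, map_zero, add_zero]
  linear_combination (C s) * h

/-- ★ **Re-centring the `y`-identity**: from `α·U·Q(F₀ + b) + (G + b)·Q′(F₀ + b)·ỹ₀ = P′(F₀ + b)·ỹ₀` to the same with `b := 0`, `Q̂`, `P̂`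
(here `U` stands for `2·Y₁∘T + a₁·X₁∘T + a₃` and `G` for `X₁∘T`). [cite: SilvermanATAEC1994, II Prop. 1.1] [cite: SilvermanAEC2009, III §1] -/
theorem cmY_identity_recenter {U G F₀ Yt : PowerSeries A} {α b : A} (s : A) {P Q : Polynomial A}
    (h : C α * U * Polynomial.aeval (F₀ + C b) Q + (G + C b) * Polynomial.aeval (F₀ + C b) (Polynomial.derivative Q) * Yt =
      Polynomial.aeval (F₀ + C b) (Polynomial.derivative P) * Yt) :
    C α * U * Polynomial.aeval (F₀ + C 0) (Polynomial.C s * Q.comp (Polynomial.X + Polynomial.C b)) +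
        (G + C 0) * Polynomial.aeval (F₀ + C 0) (Polynomial.derivative (Polynomial.C s * Q.comp (Polynomial.X + Polynomial.C b))) * Yt =
      Polynomial.aeval (F₀ + C 0) (Polynomial.derivative (Polynomial.C s * (P.comp (Polynomial.X + Polynomial.C b) -
        Polynomial.C b * Q.comp (Polynomial.X + Polynomial.C b)))) * Yt := by
  rw [derivative_C_mul_comp_X_add_C, derivative_C_mul_comp_sub, aeval_add_C_zero_C_mul_comp, aeval_add_C_zero_C_mul_comp,
    aeval_add_C_zero_C_mul_comp_sub, map_zero, add_zero]
  linear_combination (C s) * h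

end Recenter

/-! ## §2. Descent to a data ring `R` along an injective reading `φ : R → ℂ` (model `[1, −1, 0, −2, −1]`, `b = 0`) -/

section Reading

open _root_.WeierstrassCurve _root_.PeriodPair
open scoped PeriodPair

variable {R : Type*} [CommRing R] (φ : R →+* ℂ) (hφ : Function.Injective φ)
  (L : PeriodPair) {Ω₁ : ℂ} {P Q : Polynomial ℂ} (s : ℂ)
  (x₀ y₀ x₁ y₁ αR : R) (T_R : PowerSeries R) (hT0 : constantCoeff T_R = 0) (Pr Qr : Polynomial R)

include hφ hT0

/-- ★★ **The `x`-identity `hidX` over the data ring** (brick B8b): if `φ` reads `(x₀, y₀) ↦ ξ(Ω₁)`, `(x₁, y₁) ↦ ξ(αΩ₁)` in the MODEL coordinates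
of `W = [1,−1,0,−2,−1]`, `T_R ↦ exp_W(α·log_W)`, `Q̂_R ↦ s·Q(X + b₂/12)`, `P̂_R ↦ s·(P(X + b₂/12) − (b₂/12)·Q(X + b₂/12))` for a transformation pair
`P(℘ z) = ℘(αz)·Q(℘ z)` of the Néron lattice `L` of `W` (`g₂ = c₄/12`, `g₃ = c₆/216`), then over `R`:
`((translateX(x₁,y₁)) ∘ T_R + 0)·Q̂_R(translateX(x₀,y₀) + 0) = P̂_R(translateX(x₀,y₀) + 0)` — the hypothesis `hidX` of
`some_add_ptOfZ_evalPt₁_eq_of_cm_identities` with `b := 0`. [cite: deShalit1987, II §1.10, II §4.9 (ii)] [cite: SilvermanATAEC1994, II Prop. 1.1] -/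
theorem cmX_identity_of_reading
    (h₂ : L.g₂ = (⟨1, -1, 0, -2, -1⟩ : WeierstrassCurve ℂ).c₄ / 12) (h₃ : L.g₃ = (⟨1, -1, 0, -2, -1⟩ : WeierstrassCurve ℂ).c₆ / 216)
    (hT : ∀ z : ℂ, z ∉ L.lattice → φ αR * z ∉ L.lattice → P.eval (℘[L] z) = ℘[L] (φ αR * z) * Q.eval (℘[L] z))
    (hΩ : Ω₁ ∉ L.lattice) (hαΩ : φ αR * Ω₁ ∉ L.lattice)
    (hx₀ : φ x₀ = ℘[L] Ω₁ - (⟨1, -1, 0, -2, -1⟩ : WeierstrassCurve ℂ).b₂ / 12)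
    (hy₀ : φ y₀ = (℘'[L] Ω₁ - (⟨1, -1, 0, -2, -1⟩ : WeierstrassCurve ℂ).a₁ * (℘[L] Ω₁ - (⟨1, -1, 0, -2, -1⟩ : WeierstrassCurve ℂ).b₂ / 12) -
      (⟨1, -1, 0, -2, -1⟩ : WeierstrassCurve ℂ).a₃) / 2)
    (hx₁ : φ x₁ = ℘[L] (φ αR * Ω₁) - (⟨1, -1, 0, -2, -1⟩ : WeierstrassCurve ℂ).b₂ / 12)
    (hy₁ : φ y₁ = (℘'[L] (φ αR * Ω₁) - (⟨1, -1, 0, -2, -1⟩ : WeierstrassCurve ℂ).a₁ * (℘[L] (φ αR * Ω₁) -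
      (⟨1, -1, 0, -2, -1⟩ : WeierstrassCurve ℂ).b₂ / 12) - (⟨1, -1, 0, -2, -1⟩ : WeierstrassCurve ℂ).a₃) / 2)
    (hTφ : T_R.map φ = PowerSeries.subst (C (φ αR) * (⟨1, -1, 0, -2, -1⟩ : WeierstrassCurve ℂ).formalLog)
      (⟨1, -1, 0, -2, -1⟩ : WeierstrassCurve ℂ).formalExp)
    (hQr : Qr.map φ = Polynomial.C s * Q.comp (Polynomial.X + Polynomial.C ((⟨1, -1, 0, -2, -1⟩ : WeierstrassCurve ℂ).b₂ / 12)))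
    (hPr : Pr.map φ = Polynomial.C s * (P.comp (Polynomial.X + Polynomial.C ((⟨1, -1, 0, -2, -1⟩ : WeierstrassCurve ℂ).b₂ / 12)) -
      Polynomial.C ((⟨1, -1, 0, -2, -1⟩ : WeierstrassCurve ℂ).b₂ / 12) *
        Q.comp (Polynomial.X + Polynomial.C ((⟨1, -1, 0, -2, -1⟩ : WeierstrassCurve ℂ).b₂ / 12)))) :
    (PowerSeries.subst T_R ((⟨1, -1, 0, -2, -1⟩ : WeierstrassCurve R).translateX x₁ y₁) + C 0) *
        Polynomial.aeval ((⟨1, -1, 0, -2, -1⟩ : WeierstrassCurve R).translateX x₀ y₀ + C 0) Qr =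
      Polynomial.aeval ((⟨1, -1, 0, -2, -1⟩ : WeierstrassCurve R).translateX x₀ y₀ + C 0) Pr := by
  refine translateX_subst_add_C_mul_aeval_eq_of_map φ hφ _ hT0 ?_
  rw [cm7Model_map, hx₀, hy₀, hx₁, hy₁, hTφ, hQr, hPr, map_zero]
  exact cmX_identity_recenter s
    (translateX_subst_formalMulBy_add_C_mul_aeval_eq_of_transformation L (⟨1, -1, 0, -2, -1⟩ : WeierstrassCurve ℂ) h₂ h₃ hT hΩ hαΩ)

/-- ★★ **The `y`-identity `hidY` over the data ring** (brick B8b), same data plus `℘′(Ω₁) ≠ 0`, `℘′(αΩ₁) ≠ 0`: over `R`,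
`α·(2·translateY(x₁,y₁)∘T_R + a₁·translateX(x₁,y₁)∘T_R + a₃)·Q̂_R(X₀ + 0) + (translateX(x₁,y₁)∘T_R + 0)·Q̂_R′(X₀ + 0)·ỹ₀ = P̂_R′(X₀ + 0)·ỹ₀`,
`X₀ = translateX(x₀,y₀)`, `ỹ₀ = 2·translateY(x₀,y₀) + a₁·X₀ + a₃` — the hypothesis `hidY` of `some_add_ptOfZ_evalPt₁_eq_of_cm_identities` with
`b := 0`. [cite: deShalit1987, II §1.10, II §4.9 (ii)] [cite: SilvermanATAEC1994, II Prop. 1.1] -/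
theorem cmY_identity_of_reading
    (h₂ : L.g₂ = (⟨1, -1, 0, -2, -1⟩ : WeierstrassCurve ℂ).c₄ / 12) (h₃ : L.g₃ = (⟨1, -1, 0, -2, -1⟩ : WeierstrassCurve ℂ).c₆ / 216)
    (hT : ∀ z : ℂ, z ∉ L.lattice → φ αR * z ∉ L.lattice → P.eval (℘[L] z) = ℘[L] (φ αR * z) * Q.eval (℘[L] z))
    (hΩ : Ω₁ ∉ L.lattice) (hαΩ : φ αR * Ω₁ ∉ L.lattice) (hΩ' : ℘'[L] Ω₁ ≠ 0) (hαΩ' : ℘'[L] (φ αR * Ω₁) ≠ 0)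
    (hx₀ : φ x₀ = ℘[L] Ω₁ - (⟨1, -1, 0, -2, -1⟩ : WeierstrassCurve ℂ).b₂ / 12)
    (hy₀ : φ y₀ = (℘'[L] Ω₁ - (⟨1, -1, 0, -2, -1⟩ : WeierstrassCurve ℂ).a₁ * (℘[L] Ω₁ - (⟨1, -1, 0, -2, -1⟩ : WeierstrassCurve ℂ).b₂ / 12) -
      (⟨1, -1, 0, -2, -1⟩ : WeierstrassCurve ℂ).a₃) / 2)
    (hx₁ : φ x₁ = ℘[L] (φ αR * Ω₁) - (⟨1, -1, 0, -2, -1⟩ : WeierstrassCurve ℂ).b₂ / 12)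
    (hy₁ : φ y₁ = (℘'[L] (φ αR * Ω₁) - (⟨1, -1, 0, -2, -1⟩ : WeierstrassCurve ℂ).a₁ * (℘[L] (φ αR * Ω₁) -
      (⟨1, -1, 0, -2, -1⟩ : WeierstrassCurve ℂ).b₂ / 12) - (⟨1, -1, 0, -2, -1⟩ : WeierstrassCurve ℂ).a₃) / 2)
    (hTφ : T_R.map φ = PowerSeries.subst (C (φ αR) * (⟨1, -1, 0, -2, -1⟩ : WeierstrassCurve ℂ).formalLog)
      (⟨1, -1, 0, -2, -1⟩ : WeierstrassCurve ℂ).formalExp)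
    (hQr : Qr.map φ = Polynomial.C s * Q.comp (Polynomial.X + Polynomial.C ((⟨1, -1, 0, -2, -1⟩ : WeierstrassCurve ℂ).b₂ / 12)))
    (hPr : Pr.map φ = Polynomial.C s * (P.comp (Polynomial.X + Polynomial.C ((⟨1, -1, 0, -2, -1⟩ : WeierstrassCurve ℂ).b₂ / 12)) -
      Polynomial.C ((⟨1, -1, 0, -2, -1⟩ : WeierstrassCurve ℂ).b₂ / 12) *
        Q.comp (Polynomial.X + Polynomial.C ((⟨1, -1, 0, -2, -1⟩ : WeierstrassCurve ℂ).b₂ / 12)))) :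
    C αR * (2 * PowerSeries.subst T_R ((⟨1, -1, 0, -2, -1⟩ : WeierstrassCurve R).translateY x₁ y₁) +
            C (⟨1, -1, 0, -2, -1⟩ : WeierstrassCurve R).a₁ * PowerSeries.subst T_R ((⟨1, -1, 0, -2, -1⟩ : WeierstrassCurve R).translateX x₁ y₁) +
            C (⟨1, -1, 0, -2, -1⟩ : WeierstrassCurve R).a₃) *
          Polynomial.aeval ((⟨1, -1, 0, -2, -1⟩ : WeierstrassCurve R).translateX x₀ y₀ + C 0) Qr +
        (PowerSeries.subst T_R ((⟨1, -1, 0, -2, -1⟩ : WeierstrassCurve R).translateX x₁ y₁) + C 0) *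
          Polynomial.aeval ((⟨1, -1, 0, -2, -1⟩ : WeierstrassCurve R).translateX x₀ y₀ + C 0) (Polynomial.derivative Qr) *
          (2 * (⟨1, -1, 0, -2, -1⟩ : WeierstrassCurve R).translateY x₀ y₀ +
            C (⟨1, -1, 0, -2, -1⟩ : WeierstrassCurve R).a₁ * (⟨1, -1, 0, -2, -1⟩ : WeierstrassCurve R).translateX x₀ y₀ +
            C (⟨1, -1, 0, -2, -1⟩ : WeierstrassCurve R).a₃) =
      Polynomial.aeval ((⟨1, -1, 0, -2, -1⟩ : WeierstrassCurve R).translateX x₀ y₀ + C 0) (Polynomial.derivative Pr) *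
        (2 * (⟨1, -1, 0, -2, -1⟩ : WeierstrassCurve R).translateY x₀ y₀ +
          C (⟨1, -1, 0, -2, -1⟩ : WeierstrassCurve R).a₁ * (⟨1, -1, 0, -2, -1⟩ : WeierstrassCurve R).translateX x₀ y₀ +
          C (⟨1, -1, 0, -2, -1⟩ : WeierstrassCurve R).a₃) := by
  haveI := cm7Model_isElliptic (F := ℂ)
  refine cmY_identity_of_map_eq φ hφ hT0 ?_
  rw [map_translateX, map_translateX, map_translateY, map_translateY, cm7Model_map, hx₀, hy₀, hx₁, hy₁, hTφ, hQr, hPr, map_zero]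
  have ha₁ : φ (⟨1, -1, 0, -2, -1⟩ : WeierstrassCurve R).a₁ = (⟨1, -1, 0, -2, -1⟩ : WeierstrassCurve ℂ).a₁ := by simp
  rw [ha₁]
  exact cmY_identity_recenter s
    (translateY_cm_identity_of_transformation L (⟨1, -1, 0, -2, -1⟩ : WeierstrassCurve ℂ) h₂ h₃ hT hΩ hαΩ hΩ' hαΩ')

end Reading

end Literature.NumberTheory.EllipticCurves

end
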